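import Mathlib
import Summits.NavierStokesRegularity.NavierStokesRegularity.Theses.FrozenSignCascade
import Summits.NavierStokesRegularity.NavierStokesRegularity.Theorems.FrozenSignCascadeEnvelopeBoundReduction
import HarnessLib

/-!
# Route FrozenSignCascade · crux `EnvelopeBound` (stmt-NavierStokesRegularity-1549): the critical
  Fourier envelope is controlled by energy × enstrophy

Support file for the crux item stmt-NavierStokesRegularity-1549 (`EnvelopeBound`, rank 2 of route
`FrozenSignCascade`); lands `--supports` that item (line `registered`, lead c2).

**What is proved.** Along a Fourier-side mild solution `V` of Navier–Stokes on `[0, F]`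
(`FourierNS.IsFourierMild c 4 0 F V`, heat rate `c = 4π²ν`) with Fourier energy
`∫ ‖V(r,η)‖² dη ≤ E` and Fourier enstrophy `∫ ‖η‖² ‖V(r,η)‖² dη ≤ Ω` on `[0, F]`, the CRITICAL
envelope obeys, for every `λ > 0`,

  `‖ξ‖² ‖V(t,ξ)‖ ≤ ‖ξ‖² ‖V(0,ξ)‖ + (36π / c) · (λ Ω + λ⁻¹ E)`   (`envelope_le_of_enstrophy`),

i.e. (optimising `λ`) `≤ ‖ξ‖²‖V(0,ξ)‖ + (72π/c) √(E Ω)`: the scale-invariant product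
`‖u‖_{L²} ‖∇u‖_{L²}` bounds the scale-invariant `PM²` envelope. Mechanism: the one new kernel
estimate `‖ξ‖ · |(V_j ⋆ V_k)(ξ)| ≤ λ Ω + λ⁻¹ E` (`norm_mul_norm_fconv_le_of_enstrophy`: triangle
inequality `‖ξ‖ ≤ ‖η‖ + ‖ξ-η‖` moves the derivative onto one factor, then AM–GM and translation
invariance), the symbol bound `|m_{jkl}(ξ)| ≤ 2‖ξ‖` (`norm_nonlin_le_of_norm_mul_fconv_le`:
`‖N(V,V)(ξ)‖ ≤ 36π (λΩ + λ⁻¹E)` with NO residual factor `‖ξ‖`), and the Duhamel formula from time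
`0` with `c‖ξ‖² ∫₀ᵗ e^{-c‖ξ‖²(t-r)} dr ≤ 1`.

**Consequence for the crux** (`envelopeBound_of_enstrophyBound`): `EnvelopeBound` FOLLOWS from an
a-priori bound of the Fourier enstrophy `∫ ‖η‖² ∑ₗ ‖V(t,η)ₗ‖² dη` (= `‖∇u(t)‖²_{L²}/(4π²)` by
Plancherel) along the Fourier-mild solutions from the datum, uniformly up to each horizon — the
classical (Leray 1934 / Prodi–Serrin–Ladyzhenskaya) formulation of regularity. So the crux is at most
as strong as "no enstrophy blow-up", with an explicit constant; the energy hypothesis is discharged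
by the landed energy inequality `Registered.energyIneq` and the datum's envelope by
`hasDecay_fourierData 2`. This pins the crux's logical position for the planners (it is implied by
the standard subcritical a-priori bound, not merely by Clay (A) informally) and connects it to the
enstrophy vocabulary of the tree's other Navier–Stokes routes.

References: J. Leray, Acta Math. 63 (1934) §§20–21 (energy, enstrophy and regularity);
P. G. Lemarié-Rieusset, *The Navier–Stokes problem in the 21st century* (2016), §7.3 and §8.5
(mild solutions, pseudo-measure calculus); Y. Le Jan, A.-S. Sznitman, PTRF 109 (1997) (the `PM²`
envelope).
-/

noncomputable section

set_option linter.dupNamespace false -- nested layout Summit.<S>.<Sub>, Sub = S (D-0017)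

open Set MeasureTheory Filter Topology Real
open Literature.Analysis.FluidPDE Literature.Analysis.FluidPDE.FourierNS

namespace Summit.NavierStokesRegularity.NavierStokesRegularity.Theorems.EnvelopeBound.Registered

/-! ### The kernel estimate at the enstrophy level -/

/-- `‖η‖² ‖f η‖²` is integrable for `f` with decay of order `2 + K₀`, `K₀ > 3`
(`‖η‖²‖f‖² ≤ A · ‖f‖` with `‖η‖²‖f η‖ ≤ A`). -/
theorem integrable_norm_sq_mul_norm_sq_of_hasDecay {K₀ : ℕ} (hK₀ : Fintype.card (Fin 3) < K₀)
    {F : Type*} [NormedAddCommGroup F]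
    {f : EuclideanSpace ℝ (Fin 3) → F} {A : ℝ} (hf : HasDecay (2 + K₀) A f)
    (hfm : AEStronglyMeasurable f volume) :
    Integrable fun η => ‖η‖ ^ 2 * ‖f η‖ ^ 2 := by
  have hi := ((hf.of_le (Nat.le_add_left K₀ 2)).integrable (finrank_lt_of_card_lt hK₀) hfm).norm.const_mul A
  have hb : ∀ η : EuclideanSpace ℝ (Fin 3), ‖η‖ ^ 2 * ‖f η‖ ≤ A := fun η => by
    calc ‖η‖ ^ 2 * ‖f η‖ ≤ (1 + ‖η‖) ^ (2 + K₀) * ‖f η‖ := by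
          refine mul_le_mul_of_nonneg_right ?_ (norm_nonneg _)
          calc ‖η‖ ^ 2 ≤ (1 + ‖η‖) ^ 2 :=
                pow_le_pow_left₀ (norm_nonneg _) (by linarith [norm_nonneg η]) 2
            _ ≤ (1 + ‖η‖) ^ (2 + K₀) :=
                pow_le_pow_right₀ (by linarith [norm_nonneg η]) (Nat.le_add_right 2 K₀)
      _ ≤ A := weight_mul_norm_le hf η
  refine hi.mono' ((continuous_norm.pow 2).aestronglyMeasurable.mul (hfm.norm.pow 2))
    (Eventually.of_forall fun η => ?_)
  rw [Real.norm_of_nonneg (by positivity)]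
  calc ‖η‖ ^ 2 * ‖f η‖ ^ 2 = (‖η‖ ^ 2 * ‖f η‖) * ‖f η‖ := by ring
    _ ≤ A * ‖f η‖ := mul_le_mul_of_nonneg_right (hb η) (norm_nonneg _)

/-- **The convolution at the enstrophy level.** For a coefficient field `v : ℝ³ → ℂ³` with
`‖v‖²` and `‖η‖²‖v‖²` integrable and every `λ > 0`,
`‖ξ‖ · ‖(v_j ⋆ v_k)(ξ)‖ ≤ λ ∫ ‖η‖²‖v(η)‖² dη + λ⁻¹ ∫ ‖v(η)‖² dη`:
the triangle inequality `‖ξ‖ ≤ ‖η‖ + ‖ξ - η‖` puts one derivative on one factor, AM–GM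
`‖η‖ a b ≤ (λ‖η‖²a² + λ⁻¹b²)/2` bounds each piece, and translation invariance of Lebesgue measure
identifies the two halves. This is the Fourier form of `‖ξ‖ |𝓕(u ũ)(ξ)| ≲ ‖∇u‖₂‖ũ‖₂ + ‖u‖₂‖∇ũ‖₂`. -/
theorem norm_mul_norm_fconv_le_of_enstrophy {v : EuclideanSpace ℝ (Fin 3) → Fin 3 → ℂ}
    (hv2 : Integrable fun η => ‖v η‖ ^ 2)
    (hv2' : Integrable fun η => ‖η‖ ^ 2 * ‖v η‖ ^ 2) {lam : ℝ} (hlam : 0 < lam)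
    (j k : Fin 3) (ξ : EuclideanSpace ℝ (Fin 3)) :
    ‖ξ‖ * ‖fconv (v · j) (v · k) ξ‖ ≤
      lam * (∫ η, ‖η‖ ^ 2 * ‖v η‖ ^ 2) + lam⁻¹ * ∫ η, ‖v η‖ ^ 2 := by
  set Ω : ℝ := ∫ η, ‖η‖ ^ 2 * ‖v η‖ ^ 2 with hΩ
  set E : ℝ := ∫ η, ‖v η‖ ^ 2 with hE
  -- the shifted integrands
  have hs2 : Integrable fun η => ‖v (ξ - η)‖ ^ 2 := hv2.comp_sub_left ξ
  have hs2' : Integrable fun η => ‖ξ - η‖ ^ 2 * ‖v (ξ - η)‖ ^ 2 :=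
    hv2'.comp_sub_left ξ
  -- the majorant
  set g : EuclideanSpace ℝ (Fin 3) → ℝ := fun η =>
    (lam * (‖η‖ ^ 2 * ‖v η‖ ^ 2) + lam⁻¹ * ‖v (ξ - η)‖ ^ 2) / 2 +
      (lam * (‖ξ - η‖ ^ 2 * ‖v (ξ - η)‖ ^ 2) + lam⁻¹ * ‖v η‖ ^ 2) / 2 with hg
  have hA1 : Integrable (fun η => lam * (‖η‖ ^ 2 * ‖v η‖ ^ 2)) := hv2'.const_mul lam
  have hA2 : Integrable (fun η => lam⁻¹ * ‖v (ξ - η)‖ ^ 2) := hs2.const_mul lam⁻¹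
  have hB1 : Integrable (fun η => lam * (‖ξ - η‖ ^ 2 * ‖v (ξ - η)‖ ^ 2)) := hs2'.const_mul lam
  have hB2 : Integrable (fun η => lam⁻¹ * ‖v η‖ ^ 2) := hv2.const_mul lam⁻¹
  have hA : Integrable (fun η => (lam * (‖η‖ ^ 2 * ‖v η‖ ^ 2) + lam⁻¹ * ‖v (ξ - η)‖ ^ 2) / 2) :=
    (hA1.add hA2).div_const 2
  have hB : Integrable
      (fun η => (lam * (‖ξ - η‖ ^ 2 * ‖v (ξ - η)‖ ^ 2) + lam⁻¹ * ‖v η‖ ^ 2) / 2) :=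
    (hB1.add hB2).div_const 2
  have hgi : Integrable g := by rw [hg]; exact hA.add hB
  -- AM–GM: `r a b ≤ (λ r² a² + λ⁻¹ b²)/2` for `r, a, b ≥ 0`
  have amgm : ∀ r a b : ℝ, 0 ≤ r → 0 ≤ a → 0 ≤ b →
      r * a * b ≤ (lam * (r ^ 2 * a ^ 2) + lam⁻¹ * b ^ 2) / 2 := by
    intro r a b hr ha hb
    have hl : 0 < lam := hlam
    have key : 0 ≤ (lam * (r * a) - b) ^ 2 := sq_nonneg _
    have h2 : 2 * lam * (r * a * b) ≤ lam ^ 2 * (r ^ 2 * a ^ 2) + b ^ 2 := by nlinarith [key]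
    rw [le_div_iff₀ (by norm_num : (0:ℝ) < 2)]
    have h3 : lam * (lam * (r ^ 2 * a ^ 2) + lam⁻¹ * b ^ 2) = lam ^ 2 * (r ^ 2 * a ^ 2) + b ^ 2 := by
      field_simp
    nlinarith [h2, h3, mul_le_mul_of_nonneg_left (le_refl (r * a * b * 2)) hl.le]
  -- pointwise bound of the integrand
  have hpt : ∀ η, ‖ξ‖ * ‖v η j * v (ξ - η) k‖ ≤ g η := by
    intro η
    rw [norm_mul]
    have ha : ‖v η j‖ ≤ ‖v η‖ := norm_le_pi_norm (v η) j
    have hb : ‖v (ξ - η) k‖ ≤ ‖v (ξ - η)‖ := norm_le_pi_norm (v (ξ - η)) k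
    have hξ : ‖ξ‖ ≤ ‖η‖ + ‖ξ - η‖ := by
      calc ‖ξ‖ = ‖η + (ξ - η)‖ := by congr 1; abel
        _ ≤ ‖η‖ + ‖ξ - η‖ := norm_add_le _ _
    have h1 : ‖ξ‖ * (‖v η j‖ * ‖v (ξ - η) k‖) ≤ (‖η‖ + ‖ξ - η‖) * (‖v η‖ * ‖v (ξ - η)‖) :=
      mul_le_mul hξ (mul_le_mul ha hb (norm_nonneg _) (norm_nonneg _))
        (by positivity) (by positivity)
    have h2 := amgm ‖η‖ ‖v η‖ ‖v (ξ - η)‖ (norm_nonneg _) (norm_nonneg _) (norm_nonneg _)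
    have h3 := amgm ‖ξ - η‖ ‖v (ξ - η)‖ ‖v η‖ (norm_nonneg _) (norm_nonneg _) (norm_nonneg _)
    calc ‖ξ‖ * (‖v η j‖ * ‖v (ξ - η) k‖)
        ≤ (‖η‖ + ‖ξ - η‖) * (‖v η‖ * ‖v (ξ - η)‖) := h1
      _ = ‖η‖ * ‖v η‖ * ‖v (ξ - η)‖ + ‖ξ - η‖ * ‖v (ξ - η)‖ * ‖v η‖ := by ring
      _ ≤ g η := by rw [hg]; exact add_le_add h2 h3
  -- integrate
  have hint : ∫ η, g η = lam * Ω + lam⁻¹ * E := by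
    have e1 : ∫ η, ‖v (ξ - η)‖ ^ 2 = E :=
      integral_sub_left_eq_self (fun η => ‖v η‖ ^ 2) volume ξ
    have e2 : ∫ η, ‖ξ - η‖ ^ 2 * ‖v (ξ - η)‖ ^ 2 = Ω :=
      integral_sub_left_eq_self (fun η => ‖η‖ ^ 2 * ‖v η‖ ^ 2) volume ξ
    rw [hg, integral_add hA hB, integral_div, integral_div, integral_add hA1 hA2,
      integral_add hB1 hB2, integral_const_mul, integral_const_mul, integral_const_mul,
      integral_const_mul, e1, e2]
    ring
  calc ‖ξ‖ * ‖fconv (v · j) (v · k) ξ‖ = ‖ξ‖ * ‖∫ η, v η j * v (ξ - η) k‖ := by rw [fconv_apply]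
    _ ≤ ‖ξ‖ * ∫ η, ‖v η j * v (ξ - η) k‖ :=
        mul_le_mul_of_nonneg_left (norm_integral_le_integral_norm _) (norm_nonneg _)
    _ = ∫ η, ‖ξ‖ * ‖v η j * v (ξ - η) k‖ := (integral_const_mul _ _).symm
    _ ≤ ∫ η, g η :=
        integral_mono_of_nonneg (Eventually.of_forall fun η => by positivity) hgi
          (Eventually.of_forall hpt)
    _ = lam * Ω + lam⁻¹ * E := hint

/-- **The symbol bound without a residual frequency factor**: if all nine products
`‖ξ‖ · ‖(v_j ⋆ w_k)(ξ)‖` are bounded by `Y ≥ 0`, then `‖N(v, w)(ξ)‖ ≤ 36π Y`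
(`|m_{jkl}(ξ)| ≤ 2‖ξ‖`, factor `2π`, nine terms). -/
theorem norm_nonlin_le_of_norm_mul_fconv_le {v w : EuclideanSpace ℝ (Fin 3) → Fin 3 → ℂ}
    {ξ : EuclideanSpace ℝ (Fin 3)} {Y : ℝ} (hY : 0 ≤ Y)
    (h : ∀ j k, ‖ξ‖ * ‖fconv (v · j) (w · k) ξ‖ ≤ Y) :
    ‖nonlin v w ξ‖ ≤ 36 * π * Y := by
  have hterm : ∀ j k l, ‖(lerayDerivSymbol j k l ξ : ℂ) * fconv (v · j) (w · k) ξ‖ ≤ 2 * Y :=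
    fun j k l => by
    rw [norm_mul]
    calc ‖(lerayDerivSymbol j k l ξ : ℂ)‖ * ‖fconv (v · j) (w · k) ξ‖
        ≤ 2 * ‖ξ‖ * ‖fconv (v · j) (w · k) ξ‖ :=
          mul_le_mul_of_nonneg_right (norm_ofReal_lerayDerivSymbol_le j k l ξ) (norm_nonneg _)
      _ = 2 * (‖ξ‖ * ‖fconv (v · j) (w · k) ξ‖) := by ring
      _ ≤ 2 * Y := by linarith [h j k]
  refine (pi_norm_le_iff_of_nonneg (by positivity)).2 fun l => ?_
  rw [nonlin_apply, norm_mul]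
  have h2π : ‖-(2 * (π : ℂ) * Complex.I)‖ = 2 * π := by
    simp [Complex.norm_real, Real.norm_eq_abs, abs_of_pos Real.pi_pos]
  rw [h2π]
  calc 2 * π * ‖∑ j, ∑ k, (lerayDerivSymbol j k l ξ : ℂ) * fconv (v · j) (w · k) ξ‖
      ≤ 2 * π * ((Fintype.card (Fin 3) : ℝ) ^ 2 * (2 * Y)) :=
        mul_le_mul_of_nonneg_left (norm_sum_sum_le fun j k => hterm j k l) (by positivity)
    _ = 36 * π * Y := by simp; ring

/-! ### The envelope from energy and enstrophy along a mild solution -/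

/-- **The critical envelope is controlled by energy × enstrophy.** Let `V` be a Fourier-side
mild solution on `[0, F]` (heat rate `c`, weight order `4`) with `∫ ‖V(r,η)‖² dη ≤ E` and
`∫ ‖η‖² ‖V(r,η)‖² dη ≤ Ω` for `r ∈ [0, F]`. Then for every `λ > 0`, `t ∈ [0, F]` and `ξ`,
`‖ξ‖² ‖V(t,ξ)‖ ≤ ‖ξ‖² ‖V(0,ξ)‖ + (36π / c)(λ Ω + λ⁻¹ E)`.
Proof: Duhamel from time `0`; the nonlinearity is bounded by `36π(λΩ + λ⁻¹E)` uniformly in `ξ`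
(`norm_mul_norm_fconv_le_of_enstrophy`, `norm_nonlin_le_of_norm_mul_fconv_le`), and
`c‖ξ‖² ∫₀ᵗ e^{-c‖ξ‖²(t-r)} dr ≤ 1` (`mul_norm_sq_mul_integral_heat_le`). -/
theorem envelope_le_of_enstrophy {c F : ℝ} {V : ℝ → EuclideanSpace ℝ (Fin 3) → Fin 3 → ℂ}
    (h : IsFourierMild c 4 0 F V) {E Ω lam : ℝ} (hlam : 0 < lam)
    (hE : ∀ r ∈ Icc 0 F, ∫ η, ‖V r η‖ ^ 2 ≤ E)
    (hΩ : ∀ r ∈ Icc 0 F, ∫ η, ‖η‖ ^ 2 * ‖V r η‖ ^ 2 ≤ Ω) {t : ℝ} (ht : t ∈ Icc 0 F)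
    (ξ : EuclideanSpace ℝ (Fin 3)) :
    ‖ξ‖ ^ 2 * ‖V t ξ‖ ≤ ‖ξ‖ ^ 2 * ‖V 0 ξ‖ + 36 * π / c * (lam * Ω + lam⁻¹ * E) := by
  have hc := h.hc
  have hE0 : 0 ≤ E := le_trans (integral_nonneg fun η => sq_nonneg _) (hE 0 ⟨le_rfl, h.le⟩)
  have hΩ0 : 0 ≤ Ω :=
    le_trans (integral_nonneg fun η => by positivity) (hΩ 0 ⟨le_rfl, h.le⟩)
  set Y : ℝ := lam * Ω + lam⁻¹ * E with hY
  have hY0 : 0 ≤ Y := by positivity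
  -- integrability of the two slice functionals, from the decay of every order
  obtain ⟨A, -, hA⟩ := h.decay₀
  obtain ⟨A₂, hA₂⟩ := h.decay (2 + 4)
  have hi2 : ∀ r, Integrable fun η => ‖V r η‖ ^ 2 := fun r =>
    integrable_norm_sq_of_hasDecay h.hK₀ (hA r) (h.aestronglyMeasurable_slice r)
  have hi2' : ∀ r, Integrable fun η => ‖η‖ ^ 2 * ‖V r η‖ ^ 2 := fun r =>
    integrable_norm_sq_mul_norm_sq_of_hasDecay h.hK₀ (hA₂ r) (h.aestronglyMeasurable_slice r)
  -- the nonlinearity is bounded uniformly in frequency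
  have hN : ∀ r ∈ Icc 0 F, ‖nonlin (V r) (V r) ξ‖ ≤ 36 * π * Y := by
    intro r hr
    refine norm_nonlin_le_of_norm_mul_fconv_le hY0 fun j k => ?_
    calc ‖ξ‖ * ‖fconv (V r · j) (V r · k) ξ‖
        ≤ lam * (∫ η, ‖η‖ ^ 2 * ‖V r η‖ ^ 2) + lam⁻¹ * ∫ η, ‖V r η‖ ^ 2 :=
          norm_mul_norm_fconv_le_of_enstrophy (hi2 r) (hi2' r) hlam j k ξ
      _ ≤ lam * Ω + lam⁻¹ * E := by
          gcongr
          · exact hΩ r hr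
          · exact hE r hr
  -- Duhamel from time `0`
  set D : Fin 3 → ℂ := ∫ r' in (0 : ℝ)..t, heat c ξ (t - r') • nonlin (V r') (V r') ξ with hD
  have hVt : V t ξ = heat c ξ (t - 0) • V 0 ξ - D := h.duhamel le_rfl ht.1 ht.2 ξ
  have h1 : ‖V t ξ‖ ≤ ‖V 0 ξ‖ + ‖D‖ := by
    rw [hVt]
    calc ‖heat c ξ (t - 0) • V 0 ξ - D‖ ≤ ‖heat c ξ (t - 0) • V 0 ξ‖ + ‖D‖ := norm_sub_le _ _
      _ = heat c ξ (t - 0) * ‖V 0 ξ‖ + ‖D‖ := by rw [norm_heat_smul]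
      _ ≤ ‖V 0 ξ‖ + ‖D‖ := by
          gcongr
          exact mul_le_of_le_one_left (norm_nonneg _) (heat_le_one hc.le (by linarith [ht.1]) ξ)
  -- the Duhamel term against the heat integral
  have hD1 : ‖D‖ ≤ ∫ r' in (0 : ℝ)..t, heat c ξ (t - r') * ‖nonlin (V r') (V r') ξ‖ :=
    (intervalIntegral.norm_integral_le_integral_norm ht.1).trans_eq
      (intervalIntegral.integral_congr fun r' _ => by simp only [norm_heat_smul])
  have hcont1 : Continuous fun r' => heat c ξ (t - r') * ‖nonlin (V r') (V r') ξ‖ :=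
    (continuous_heat_comp c continuous_const (continuous_const.sub continuous_id)).mul
      (h.continuous_nonlin_time ξ).norm
  have hcont2 : Continuous fun r' => heat c ξ (t - r') * (36 * π * Y) :=
    (continuous_heat_comp c continuous_const (continuous_const.sub continuous_id)).mul
      continuous_const
  have hD2 : ∫ r' in (0 : ℝ)..t, heat c ξ (t - r') * ‖nonlin (V r') (V r') ξ‖ ≤
      ∫ r' in (0 : ℝ)..t, heat c ξ (t - r') * (36 * π * Y) :=
    intervalIntegral.integral_mono_on ht.1 (hcont1.intervalIntegrable _ _)
      (hcont2.intervalIntegrable _ _) fun r' hr' =>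
        mul_le_mul_of_nonneg_left (hN r' ⟨hr'.1, hr'.2.trans ht.2⟩) (heat_nonneg _ _ _)
  have hDle : ‖D‖ ≤ (∫ r' in (0 : ℝ)..t, heat c ξ (t - r')) * (36 * π * Y) :=
    hD1.trans (hD2.trans_eq (intervalIntegral.integral_mul_const _ _))
  have hheat := mul_norm_sq_mul_integral_heat_le c ξ 0 t
  have key : ‖ξ‖ ^ 2 * ‖D‖ ≤ 36 * π / c * Y := by
    calc ‖ξ‖ ^ 2 * ‖D‖ ≤ ‖ξ‖ ^ 2 * ((∫ r' in (0 : ℝ)..t, heat c ξ (t - r')) * (36 * π * Y)) :=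
          mul_le_mul_of_nonneg_left hDle (sq_nonneg _)
      _ = (c * ‖ξ‖ ^ 2 * ∫ r' in (0 : ℝ)..t, heat c ξ (t - r')) * (36 * π / c * Y) := by
          field_simp
      _ ≤ 1 * (36 * π / c * Y) := mul_le_mul_of_nonneg_right hheat (by positivity)
      _ = 36 * π / c * Y := one_mul _
  calc ‖ξ‖ ^ 2 * ‖V t ξ‖ ≤ ‖ξ‖ ^ 2 * (‖V 0 ξ‖ + ‖D‖) :=
        mul_le_mul_of_nonneg_left h1 (sq_nonneg _)
    _ = ‖ξ‖ ^ 2 * ‖V 0 ξ‖ + ‖ξ‖ ^ 2 * ‖D‖ := by ring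
    _ ≤ ‖ξ‖ ^ 2 * ‖V 0 ξ‖ + 36 * π / c * Y := by linarith [key]

/-! ### Consequences for the crux -/

/-- **The crux from an enstrophy a-priori bound.** If for every `ν > 0`, Clay datum `u₀` and
horizon `T₀ > 0` the Fourier enstrophy `∫ ‖η‖² ‖V(t,η)‖² dη` (sup norm on `ℂ³`; it is dominated by
`∫ ‖η‖² ∑ₗ ‖V(t,η)ₗ‖² dη = ‖∇u(t)‖²_{L²} / (4π²)`) is bounded by some `Ω(ν,u₀,T₀)` along every
Fourier-mild solution from the datum on `[0,T]`, `T ≤ T₀`, then `EnvelopeBound` holds, with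
`C = A₂ + (36π / 4π²ν)(Ω + Λ)`, `‖ξ‖²‖a(ξ)‖ ≤ A₂` (`hasDecay_fourierData 2`), `Λ = ∫ ∑ₗ ‖aₗ‖²` the
energy of the datum (the energy hypothesis of `envelope_le_of_enstrophy` is the landed energy
inequality `Registered.energyIneq`). The crux is thus implied by the classical subcritical
(`H¹`) a-priori bound (Leray 1934): it is at most as strong as "no enstrophy blow-up". -/
theorem envelopeBound_of_enstrophyBound :
    (∀ ν : ℝ, 0 < ν →
      ∀ (u₀ : EuclideanSpace ℝ (Fin 3) → EuclideanSpace ℝ (Fin 3)) (hu : ContDiff ℝ (⊤ : ℕ∞) u₀)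
        (hd : Literature.Analysis.FluidPDE.HasRapidSpatialDecay u₀),
        Literature.Analysis.FluidPDE.NSWave0.IsDivFree u₀ →
      ∀ T₀ : ℝ, 0 < T₀ → ∃ Ω : ℝ, ∀ T : ℝ, T ≤ T₀ →
        ∀ V : ℝ → EuclideanSpace ℝ (Fin 3) → Fin 3 → ℂ,
          Literature.Analysis.FluidPDE.FourierNS.IsFourierMild (4 * Real.pi ^ 2 * ν) 4 0 T V →
          V 0 = Literature.Analysis.FluidPDE.FourierNS.fourierData hu hd →
          ∀ t ∈ Set.Icc 0 T, ∫ η, ‖η‖ ^ 2 * ‖V t η‖ ^ 2 ≤ Ω) →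
    Summit.NavierStokesRegularity.NavierStokesRegularity.Theses.FrozenSignCascade.EnvelopeBound := by
  intro hens ν hν u₀ hu hd hdiv T₀ hT₀
  obtain ⟨Ω, hΩ⟩ := hens ν hν u₀ hu hd hdiv T₀ hT₀
  obtain ⟨A₂, hA₂⟩ := hasDecay_fourierData hu hd (2 + 0)
  set Λ : ℝ := ∫ η, ∑ l, ‖fourierData hu hd η l‖ ^ 2 with hΛ
  refine ⟨A₂ + 36 * π / (4 * Real.pi ^ 2 * ν) * (1 * Ω + 1⁻¹ * Λ), ?_⟩
  intro T hT V hV hV0 t ht ξ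
  -- energy in the sup norm on `ℂ³` along `V`, from the energy inequality
  have hE : ∀ r ∈ Set.Icc 0 T, ∫ η, ‖V r η‖ ^ 2 ≤ Λ := by
    intro r hr
    have hEr := energyIneq _ _ _ _ V hV r hr
    rw [hV0] at hEr
    refine le_trans ?_ hEr
    obtain ⟨A, -, hA⟩ := hV.decay₀
    have hint : Integrable (fun η => ∑ l, ‖V r η l‖ ^ 2) :=
      integrable_finsetSum _ fun l _ =>
        integrable_norm_sq_of_hasDecay hV.hK₀ ((hA r).apply l)
          ((continuous_apply l).comp (hV.continuous_slice r)).aestronglyMeasurable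
    exact integral_mono_of_nonneg (Eventually.of_forall fun η => sq_nonneg _) hint
      (Eventually.of_forall fun η => norm_sq_le_sum_norm_sq (V r η))
  have h1 := envelope_le_of_enstrophy hV one_pos hE (fun r hr => hΩ T hT V hV hV0 r hr) ht ξ
  have h2 : ‖ξ‖ ^ 2 * ‖V 0 ξ‖ ≤ A₂ := by
    rw [hV0]
    simpa using hA₂.pow_mul_norm_le (n := 2) (K := 0) ξ
  linarith

/-- **The envelope of a datum that is solvable up to the horizon.** If the Fourier datum `a`
admits SOME Fourier-mild solution `U` on the whole of `[0, T₀]`, then the critical envelope of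
every Fourier-mild solution from `a` on `[0,T]`, `T ≤ T₀`, is bounded by one constant (the
order-`2` weight of `U`, transferred by uniqueness `Registered.stub_mildUnique`). -/
theorem envelope_bounded_of_exists_mild {c T₀ : ℝ} {K₀ : ℕ}
    {a : EuclideanSpace ℝ (Fin 3) → Fin 3 → ℂ}
    (hex : ∃ U : ℝ → EuclideanSpace ℝ (Fin 3) → Fin 3 → ℂ, IsFourierMild c K₀ 0 T₀ U ∧ U 0 = a) :
    ∃ C : ℝ, ∀ T : ℝ, T ≤ T₀ → ∀ V : ℝ → EuclideanSpace ℝ (Fin 3) → Fin 3 → ℂ,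
      IsFourierMild c K₀ 0 T V → V 0 = a →
      ∀ t ∈ Set.Icc 0 T, ∀ ξ : EuclideanSpace ℝ (Fin 3), ‖ξ‖ ^ 2 * ‖V t ξ‖ ≤ C := by
  obtain ⟨U, hU, hU0⟩ := hex
  obtain ⟨A, hA⟩ := hU.decay (2 + 0)
  refine ⟨A, fun T hT V hV hV0 t ht ξ => ?_⟩
  have hVU : V t = U t :=
    stub_mildUnique _ _ _ _ _ V U hV hU (hV0.trans hU0.symm) t ht.1 ht.2 (ht.2.trans hT)
  rw [congrFun hVU ξ]
  simpa using (hA t).pow_mul_norm_le (n := 2) (K := 0) ξ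

/-- **The crux from global existence in the Fourier-mild class.** If every Clay datum launches,
for every `T > 0`, a Fourier-mild solution on `[0, T]` (global existence of the smooth, all-order
decaying solution — the Fourier-side form of global regularity), then `EnvelopeBound` holds
(`envelope_bounded_of_exists_mild` at `T = T₀`). Together with `envelopeBound_of_enstrophyBound`
this brackets the crux: it is implied by each of the two classical formulations of regularity,
and it fails exactly at a finite-time singularity at which the `PM²` envelope is unbounded. -/
theorem envelopeBound_of_globalMild :
    (∀ ν : ℝ, 0 < ν →
      ∀ (u₀ : EuclideanSpace ℝ (Fin 3) → EuclideanSpace ℝ (Fin 3)) (hu : ContDiff ℝ (⊤ : ℕ∞) u₀)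
        (hd : Literature.Analysis.FluidPDE.HasRapidSpatialDecay u₀),
        Literature.Analysis.FluidPDE.NSWave0.IsDivFree u₀ →
      ∀ T : ℝ, 0 < T → ∃ V : ℝ → EuclideanSpace ℝ (Fin 3) → Fin 3 → ℂ,
        Literature.Analysis.FluidPDE.FourierNS.IsFourierMild (4 * Real.pi ^ 2 * ν) 4 0 T V ∧
        V 0 = Literature.Analysis.FluidPDE.FourierNS.fourierData hu hd) →
    Summit.NavierStokesRegularity.NavierStokesRegularity.Theses.FrozenSignCascade.EnvelopeBound := by
  intro hglob ν hν u₀ hu hd hdiv T₀ hT₀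
  exact envelope_bounded_of_exists_mild (hglob ν hν u₀ hu hd hdiv T₀ hT₀)

end Summit.NavierStokesRegularity.NavierStokesRegularity.Theorems.EnvelopeBound.Registered

end
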